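import Literature.AlgebraicGeometry.RealAlgebraic.SubmanifoldTangent
import Literature.NumberTheory.Transcendental.SemialgebraicMapsProofs
import HarnessLib

/-!
# Tangent spaces of semialgebraic submanifolds are semialgebraic

Let `k ⊆ ℝ` be a coefficient ring and `S ⊆ ℝᵖ` a `k`-semialgebraic `C^∞` submanifold of
dimension `d` (`IsSubmanifoldOfDim`, file `RealAlgebraic/RealAbelJacobi`). Using the first-order
description of tangent spaces by the secant cone (`secantCone_eq_tangentSpace`, file
`RealAlgebraic/SubmanifoldTangent`) and Tarski–Seidenberg (the tree's
`IsSemialgebraic.image_castAdd`), this file proves: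

* `isSemialgebraic_secantBundle` — the set `{(x, v) | x ∈ S, v ∈ secantCone S x} ⊆ ℝᵖ × ℝᵖ`
  (the tangent bundle of `S`, for a submanifold) is `k`-semialgebraic;
* `isSemialgebraicMapOn_orthProj_single` — the matrix entries of the orthogonal projection onto
  `T_x S` are `k`-semialgebraic functions of `x ∈ S`;
* `IsSubmanifoldOfDim.graph`, `tangentVelocities_graph` — the graph of a `C^∞` map over `S` is a
  submanifold whose tangent vectors are `(v, DF(x) v)`;
* `isSemialgebraicMapOn_fderiv_apply` — for a `C^∞` map `F` which is `k`-semialgebraic on `S` and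
  a `k`-semialgebraic tangent vector field `u` on `S`, the directional derivative
  `x ↦ DF(x)(u x)` is a `k`-semialgebraic map on `S` (the derivative along `S` is read off the
  tangent bundle of the graph, a semialgebraic set).

These give the semialgebraicity of the coefficients of the invariant coframe
`ωᵢ(x) = ℓᵢ ∘ D₂τ(x) ∘ π_x` on the real points of an abelian variety
(`RealAbelJacobi.exists_realization`). The first-order formulas are assembled on sum-indexed
coordinate spaces (`IsSemialgebraic.exists_sum_elim`, `IsSemialgebraic.forall_sum_elim`:
quantification over a block of coordinates). Standard real algebraic geometry
(Bochnak–Coste–Roy, Prop. 2.2.4 (first-order definable sets are semialgebraic), Prop. 2.9.x /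
Prop. 3.3.x for tangent spaces of Nash manifolds); no named fact is introduced.

## References

* J. Bochnak, M. Coste, M.-F. Roy, *Real Algebraic Geometry* (1998), Thm. 2.2.1, Prop. 2.2.4,
  Def. 2.2.5, Prop. 3.3.11. [BochnakCosteRoy1998]
* S. Basu, R. Pollack, M.-F. Roy, *Algorithms in Real Algebraic Geometry* (2006), Thm. 2.76,
  Cor. 2.78. [BasuPollackRoy2006]
-/

noncomputable section

open Set Filter Function MvPolynomial
open scoped ContDiff Topology Matrix

namespace Literature.AlgebraicGeometry.RealAlgebraic

open Literature.ModelTheory.ExponentialFields Literature.NumberTheory.Transcendental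

/-! ### Toolkit: first-order formulas on sum-indexed coordinate spaces -/

section Toolkit

variable {k : Type*} [CommRing k] [Algebra k ℝ]

/-- **Existential quantification over a block of coordinates** preserves `k`-semialgebraicity:
if `W ⊆ ℝ^{ι ⊔ κ}` is `k`-semialgebraic then so is `{z ∈ ℝ^ι | ∃ y ∈ ℝ^κ, (z, y) ∈ W}`
(iterated Tarski–Seidenberg, transported along enumerations of `ι`, `κ`).
[cite: BasuPollackRoy2006, Thm. 2.76] -/
theorem _root_.Literature.ModelTheory.ExponentialFields.IsSemialgebraic.exists_sum_elim
    {ι κ : Type*} [Fintype ι] [Fintype κ] {W : Set (ι ⊕ κ → ℝ)} (hW : IsSemialgebraic k W) :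
    IsSemialgebraic k {z : ι → ℝ | ∃ y : κ → ℝ, Sum.elim z y ∈ W} := by
  classical
  set p := Fintype.card ι with hp
  set q := Fintype.card κ with hq
  set eι : ι ≃ Fin p := Fintype.equivFin ι with heι
  set eκ : κ ≃ Fin q := Fintype.equivFin κ with heκ
  set E : ι ⊕ κ ≃ Fin (p + q) := (eι.sumCongr eκ).trans finSumFinEquiv with hE
  have hEl : ∀ a : ι, E (Sum.inl a) = Fin.castAdd q (eι a) := fun a => by
    simp [hE, Equiv.sumCongr]
  have hEr : ∀ b : κ, E (Sum.inr b) = Fin.natAdd p (eκ b) := fun b => by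
    simp [hE, Equiv.sumCongr]
  have hW' : IsSemialgebraic k ((fun w' : Fin (p + q) → ℝ => w' ∘ E) ⁻¹' W) := hW.preimage_comp E
  have hV := hW'.image_castAdd (p := p) (n := q)
  have hT := hV.preimage_comp (ι := ι) eι.symm
  convert hT using 1
  ext z
  simp only [mem_setOf_eq, mem_preimage, mem_image]
  constructor
  · rintro ⟨y, hy⟩
    refine ⟨Sum.elim z y ∘ E.symm, ?_, ?_⟩
    · have : (Sum.elim z y ∘ ⇑E.symm) ∘ ⇑E = Sum.elim z y := by
        funext s
        simp
      rw [this]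
      exact hy
    · funext i
      have : E.symm (Fin.castAdd q i) = Sum.inl (eι.symm i) := by
        rw [Equiv.symm_apply_eq, hEl, Equiv.apply_symm_apply]
      simp [this]
  · rintro ⟨w', hw', hz⟩
    refine ⟨fun b => w' (E (Sum.inr b)), ?_⟩
    have hza : ∀ a, z a = w' (E (Sum.inl a)) := fun a => by
      have h := congrFun hz (eι a)
      simp only [Function.comp_apply, Equiv.symm_apply_apply] at h
      rw [← h, hEl]
    have : Sum.elim z (fun b => w' (E (Sum.inr b))) = w' ∘ E := by
      funext s
      cases s with
      | inl a => exact hza a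
      | inr b => rfl
    rw [this]
    exact hw'

/-- **Universal quantification over a block of coordinates** preserves `k`-semialgebraicity
(complement – projection – complement). [cite: BasuPollackRoy2006, Cor. 2.78] -/
theorem _root_.Literature.ModelTheory.ExponentialFields.IsSemialgebraic.forall_sum_elim
    {ι κ : Type*} [Fintype ι] [Fintype κ] {W : Set (ι ⊕ κ → ℝ)} (hW : IsSemialgebraic k W) :
    IsSemialgebraic k {z : ι → ℝ | ∀ y : κ → ℝ, Sum.elim z y ∈ W} := by
  convert (hW.compl.exists_sum_elim).compl using 1
  ext z
  simp

/-- Existential quantification over one real variable (block `Unit`). [folklore] -/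
theorem _root_.Literature.ModelTheory.ExponentialFields.IsSemialgebraic.exists_real
    {ι : Type*} [Fintype ι] {W : Set (ι ⊕ Unit → ℝ)} (hW : IsSemialgebraic k W) :
    IsSemialgebraic k {z : ι → ℝ | ∃ t : ℝ, Sum.elim z (fun _ => t) ∈ W} := by
  convert hW.exists_sum_elim using 1
  ext z
  simp only [mem_setOf_eq]
  constructor
  · rintro ⟨t, ht⟩
    exact ⟨fun _ => t, ht⟩
  · rintro ⟨y, hy⟩
    refine ⟨y (), ?_⟩
    have : (fun _ : Unit => y ()) = y := funext fun u => by cases u; rfl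
    rw [this]
    exact hy

/-- Universal quantification over one real variable (block `Unit`). [folklore] -/
theorem _root_.Literature.ModelTheory.ExponentialFields.IsSemialgebraic.forall_real
    {ι : Type*} [Fintype ι] {W : Set (ι ⊕ Unit → ℝ)} (hW : IsSemialgebraic k W) :
    IsSemialgebraic k {z : ι → ℝ | ∀ t : ℝ, Sum.elim z (fun _ => t) ∈ W} := by
  convert hW.forall_sum_elim using 1
  ext z
  simp only [mem_setOf_eq]
  constructor
  · intro h y
    have : y = fun _ : Unit => y () := funext fun u => by cases u; rfl
    rw [this]
    exact h _
  · intro h t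
    exact h _

/-- A condition which is `k`-semialgebraic as a set is `k`-semialgebraic (bookkeeping form of
`IsSemialgebraic` for predicates given pointwise). [folklore] -/
theorem sa_of_iff {ι : Type*} {P : (ι → ℝ) → Prop} {T : Set (ι → ℝ)} (hQ : IsSemialgebraic k T)
    (h : ∀ w, P w ↔ w ∈ T) : IsSemialgebraic k {w | P w} := by
  rw [show {w | P w} = T from Set.ext h]
  exact hQ

/-- The atom `0 < w a` on `ℝ^ι`. [cite: BochnakCosteRoy1998, Def. 2.1.4] -/
theorem sa_pos_at {ι : Type*} (a : ι) : IsSemialgebraic k {w : ι → ℝ | 0 < w a} :=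
  sa_of_iff (isSemialgebraic_setOf_eval_pos (k := k) (R := ℝ) (X a : MvPolynomial ι k))
    fun w => by simp

/-- The atom `w a < w b` on `ℝ^ι`. [cite: BochnakCosteRoy1998, Def. 2.1.4] -/
theorem sa_lt_at {ι : Type*} (a b : ι) : IsSemialgebraic k {w : ι → ℝ | w a < w b} :=
  sa_of_iff (isSemialgebraic_setOf_eval_lt (k := k) (R := ℝ) (X a : MvPolynomial ι k) (X b))
    fun w => by simp

/-- The closeness atom `|w y - w x - w t · w v| ≤ w e · w t` on `ℝ^ι` (two polynomial
inequalities). [cite: BochnakCosteRoy1998, Def. 2.1.4] -/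
theorem sa_close_at {ι : Type*} (y x t v e : ι) :
    IsSemialgebraic k {w : ι → ℝ | |w y - w x - w t * w v| ≤ w e * w t} := by
  have h1 := isSemialgebraic_setOf_eval_le (k := k) (R := ℝ)
    (X y - X x - X t * X v : MvPolynomial ι k) (X e * X t)
  have h2 := isSemialgebraic_setOf_eval_le (k := k) (R := ℝ)
    (-(X e * X t) : MvPolynomial ι k) (X y - X x - X t * X v)
  refine sa_of_iff (h1.inter h2) fun w => ?_
  simp only [mem_setOf_eq, mem_inter_iff, map_sub, map_mul, map_neg, aeval_X, abs_le]
  exact and_comm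

end Toolkit

/-! ### The secant bundle of a semialgebraic set is semialgebraic -/

section SecantBundle

variable {k : Type*} [CommRing k] [Algebra k ℝ] {p : ℕ}

/-- Index type of the free variables `(x, v)` of the secant-cone formula. [folklore] -/
abbrev SecIdx₀ (p : ℕ) := Fin p ⊕ Fin p
/-- … with `ε` adjoined. [folklore] -/
abbrev SecIdx₁ (p : ℕ) := SecIdx₀ p ⊕ Unit
/-- … with `t` adjoined. [folklore] -/
abbrev SecIdx₂ (p : ℕ) := SecIdx₁ p ⊕ Unit
/-- … with the block `y` adjoined: all variables of the secant-cone formula. [folklore] -/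
abbrev SecIdx₃ (p : ℕ) := SecIdx₂ p ⊕ Fin p

/-- The quantifier-free matrix of the secant-cone formula:
`0 < t ∧ t < ε ∧ y ∈ S ∧ ∀ i, |yᵢ - xᵢ - t vᵢ| ≤ ε t`. [folklore] -/
def secMatrix (S : Set (Fin p → ℝ)) : Set (SecIdx₃ p → ℝ) :=
  {w | 0 < w (Sum.inl (Sum.inr ())) ∧
    w (Sum.inl (Sum.inr ())) < w (Sum.inl (Sum.inl (Sum.inr ()))) ∧
    (fun i => w (Sum.inr i)) ∈ S ∧
    ∀ i : Fin p, |w (Sum.inr i) - w (Sum.inl (Sum.inl (Sum.inl (Sum.inl i)))) -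
      w (Sum.inl (Sum.inr ())) * w (Sum.inl (Sum.inl (Sum.inl (Sum.inr i))))| ≤
      w (Sum.inl (Sum.inl (Sum.inr ()))) * w (Sum.inl (Sum.inr ()))}

/-- The matrix of the secant-cone formula is semialgebraic. [cite: BochnakCosteRoy1998, Prop. 2.2.4] -/
theorem isSemialgebraic_secMatrix {S : Set (Fin p → ℝ)} (hS : IsSemialgebraic k S) :
    IsSemialgebraic k (secMatrix S) := by
  classical
  have h3 : IsSemialgebraic k {w : SecIdx₃ p → ℝ | (fun i => w (Sum.inr i)) ∈ S} :=
    hS.preimage_comp Sum.inr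
  have h4 : IsSemialgebraic k {w : SecIdx₃ p → ℝ | ∀ i : Fin p,
      |w (Sum.inr i) - w (Sum.inl (Sum.inl (Sum.inl (Sum.inl i)))) -
        w (Sum.inl (Sum.inr ())) * w (Sum.inl (Sum.inl (Sum.inl (Sum.inr i))))| ≤
        w (Sum.inl (Sum.inl (Sum.inr ()))) * w (Sum.inl (Sum.inr ()))} := by
    convert IsSemialgebraic.biInter (k := k) (R := ℝ) (Finset.univ : Finset (Fin p))
      (fun i => {w : SecIdx₃ p → ℝ |
        |w (Sum.inr i) - w (Sum.inl (Sum.inl (Sum.inl (Sum.inl i)))) -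
          w (Sum.inl (Sum.inr ())) * w (Sum.inl (Sum.inl (Sum.inl (Sum.inr i))))| ≤
          w (Sum.inl (Sum.inl (Sum.inr ()))) * w (Sum.inl (Sum.inr ()))})
      (fun i _ => sa_close_at _ _ _ _ _) using 1
    ext w
    simp
  exact ((sa_pos_at _).inter ((sa_lt_at _ _).inter (h3.inter h4)))

/-- **The secant bundle is semialgebraic** (sum-indexed form): for `S ⊆ ℝᵖ` `k`-semialgebraic,
`{(x, v) | x ∈ S ∧ v ∈ secantCone S x}` is `k`-semialgebraic (a first-order formula over `S`:
`∀ ε > 0 ∃ t ∃ y, …`). [cite: BochnakCosteRoy1998, Prop. 2.2.4] -/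
theorem isSemialgebraic_secantBundle_sum {S : Set (Fin p → ℝ)} (hS : IsSemialgebraic k S) :
    IsSemialgebraic k {z : SecIdx₀ p → ℝ |
      (fun i => z (Sum.inl i)) ∈ S ∧ (fun i => z (Sum.inr i)) ∈ secantCone S fun i => z (Sum.inl i)} := by
  have hM := isSemialgebraic_secMatrix (k := k) hS
  -- `∃ y`
  have h2 : IsSemialgebraic k {u : SecIdx₂ p → ℝ | ∃ y : Fin p → ℝ, Sum.elim u y ∈ secMatrix S} :=
    hM.exists_sum_elim
  -- `∃ t`
  have h1 : IsSemialgebraic k {u : SecIdx₁ p → ℝ |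
      ∃ t : ℝ, Sum.elim u (fun _ => t) ∈
        {u : SecIdx₂ p → ℝ | ∃ y : Fin p → ℝ, Sum.elim u y ∈ secMatrix S}} :=
    h2.exists_real
  -- `0 < ε → …`
  have h1' : IsSemialgebraic k {u : SecIdx₁ p → ℝ | 0 < u (Sum.inr ()) →
      ∃ t : ℝ, Sum.elim u (fun _ => t) ∈
        {u : SecIdx₂ p → ℝ | ∃ y : Fin p → ℝ, Sum.elim u y ∈ secMatrix S}} := by
    convert (sa_pos_at (k := k) (ι := SecIdx₁ p) (Sum.inr ())).compl.union h1 using 1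
    ext u
    simp only [mem_setOf_eq, mem_union, mem_compl_iff, imp_iff_not_or]
  -- `∀ ε`
  have h0 := h1'.forall_real
  -- `x ∈ S`
  have hx : IsSemialgebraic k {z : SecIdx₀ p → ℝ | (fun i => z (Sum.inl i)) ∈ S} :=
    hS.preimage_comp Sum.inl
  refine sa_of_iff (hx.inter h0) fun z => ?_
  simp only [mem_setOf_eq, mem_inter_iff, secantCone, secMatrix, Sum.elim_inl, Sum.elim_inr]
  refine and_congr_right fun _ => ⟨fun h ε hε => ?_, fun h ε hε => ?_⟩
  · obtain ⟨t, ht0, htε, y, hyS, hy⟩ := h ε hε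
    exact ⟨t, y, ht0, htε, hyS, hy⟩
  · obtain ⟨t, y, ht0, htε, hyS, hy⟩ := h ε hε
    exact ⟨t, ht0, htε, y, hyS, hy⟩

/-- **The secant bundle is semialgebraic** (appended-coordinates form on `ℝ^{p+p}`).
[cite: BochnakCosteRoy1998, Prop. 2.2.4] -/
theorem isSemialgebraic_secantBundle {S : Set (Fin p → ℝ)} (hS : IsSemialgebraic k S) :
    IsSemialgebraic k {z : Fin (p + p) → ℝ | (fun i => z (Fin.castAdd p i)) ∈ S ∧
      (fun i => z (Fin.natAdd p i)) ∈ secantCone S fun i => z (Fin.castAdd p i)} := by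
  convert (isSemialgebraic_secantBundle_sum (k := k) hS).preimage_comp
    (finSumFinEquiv : Fin p ⊕ Fin p → Fin (p + p)) using 1
  ext z
  simp only [mem_setOf_eq, mem_preimage, Function.comp_apply, finSumFinEquiv_apply_left,
    finSumFinEquiv_apply_right]

end SecantBundle


/-! ### The tangent projection has semialgebraic entries -/

section OrthProjSemialgebraic

variable {k : Type*} [CommRing k] [Algebra k ℝ] {p d : ℕ} {S : Set (Fin p → ℝ)}

/-- Index type `(x, u)` of the graph of `x ↦ π_x e_j`. [folklore] -/
abbrev ProjIdx₀ (p : ℕ) := Fin p ⊕ Fin p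
/-- … with the block `v` (test tangent vector) adjoined. [folklore] -/
abbrev ProjIdx₁ (p : ℕ) := ProjIdx₀ p ⊕ Fin p

/-- The matrix `(x, v) ∈ secant bundle → (e_j - u) ⬝ v = 0` of the projection formula.
[folklore] -/
def projMatrix (S : Set (Fin p → ℝ)) (j : Fin p) : Set (ProjIdx₁ p → ℝ) :=
  {w | ((fun i => w (Sum.inl (Sum.inl i))) ∈ S ∧
      (fun i => w (Sum.inr i)) ∈ secantCone S fun i => w (Sum.inl (Sum.inl i))) →
    w (Sum.inr j) - ∑ i, w (Sum.inl (Sum.inr i)) * w (Sum.inr i) = 0}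

/-- The matrix of the projection formula is semialgebraic. [cite: BochnakCosteRoy1998, Prop. 2.2.4] -/
theorem isSemialgebraic_projMatrix (hS : IsSemialgebraic k S) (j : Fin p) :
    IsSemialgebraic k (projMatrix S j) := by
  classical
  let θ : SecIdx₀ p → ProjIdx₁ p := Sum.elim (fun i => Sum.inl (Sum.inl i)) Sum.inr
  have hTB := (isSemialgebraic_secantBundle_sum (k := k) hS).preimage_comp θ
  have hatom := isSemialgebraic_setOf_eval_eq_zero (k := k) (R := ℝ)
    (X (Sum.inr j) - ∑ i : Fin p, X (Sum.inl (Sum.inr i)) * X (Sum.inr i) :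
      MvPolynomial (ProjIdx₁ p) k)
  refine sa_of_iff (hTB.compl.union hatom) fun w => ?_
  simp only [mem_union, mem_compl_iff, mem_preimage, mem_setOf_eq, Function.comp_apply,
    map_sub, map_sum, map_mul, aeval_X, imp_iff_not_or, θ, Sum.elim_inl, Sum.elim_inr]

/-- **The graph of `x ↦ π_x e_j` is semialgebraic** (sum-indexed form): for a `k`-semialgebraic
`C^∞` submanifold `S ⊆ ℝᵖ`, the set of `(x, u)` with `x ∈ S` and `u =` orthogonal projection of
`e_j` onto `T_x S` is `k`-semialgebraic (`u ∈ T_x S ∧ ∀ v ∈ T_x S, (e_j - u) ⬝ v = 0`, with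
`T_x S` the secant cone). [cite: BochnakCosteRoy1998, Prop. 2.2.4 and Prop. 3.3.11] -/
theorem isSemialgebraic_graph_orthProj_sum (hS : IsSubmanifoldOfDim d S) (hSsa : IsSemialgebraic k S)
    (j : Fin p) :
    IsSemialgebraic k {z : ProjIdx₀ p → ℝ | (fun i => z (Sum.inl i)) ∈ S ∧
      (fun i => z (Sum.inr i)) =
        orthProj (tangentSpace S fun i => z (Sum.inl i)) (Pi.single j 1)} := by
  classical
  have hM := isSemialgebraic_projMatrix (k := k) hSsa j
  have hL := hM.forall_sum_elim
  have hTB := isSemialgebraic_secantBundle_sum (k := k) hSsa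
  refine sa_of_iff (hTB.inter hL) fun z => ?_
  simp only [mem_inter_iff, mem_setOf_eq, projMatrix, Sum.elim_inl, Sum.elim_inr]
  constructor
  · rintro ⟨hx, hu⟩
    refine ⟨⟨hx, ?_⟩, fun v hv => ?_⟩
    · rw [hu, secantCone_eq_tangentSpace hS hx]
      exact orthProj_mem _ _
    · obtain ⟨-, hv⟩ := hv
      rw [secantCone_eq_tangentSpace hS hx] at hv
      have h := dotProduct_sub_orthProj_eq_zero (tangentSpace S fun i => z (Sum.inl i))
        (Pi.single j 1) hv
      rw [← hu, sub_dotProduct, single_dotProduct, one_mul] at h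
      simpa [dotProduct] using h
  · rintro ⟨⟨hx, hu⟩, hall⟩
    refine ⟨hx, ?_⟩
    rw [secantCone_eq_tangentSpace hS hx] at hu
    symm
    refine orthProj_eq_of_mem_of_dotProduct_eq_zero _ hu fun v hv => ?_
    have hv' : v ∈ secantCone S fun i => z (Sum.inl i) := by
      rw [secantCone_eq_tangentSpace hS hx]
      exact hv
    have h := hall v ⟨hx, hv'⟩
    rw [sub_dotProduct, single_dotProduct, one_mul]
    simpa [dotProduct] using h

/-- **The entries of the tangent projection are semialgebraic**: for a `k`-semialgebraic `C^∞`
submanifold `S ⊆ ℝᵖ` and each `j`, `x ↦ π_x e_j` (the orthogonal projection of the `j`-th basis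
vector onto `T_x S`) is a `k`-semialgebraic map on `S`.
[cite: BochnakCosteRoy1998, Prop. 2.2.4 and Prop. 3.3.11] -/
theorem isSemialgebraicMapOn_orthProj_single (hS : IsSubmanifoldOfDim d S)
    (hSsa : IsSemialgebraic k S) (j : Fin p) :
    IsSemialgebraicMapOn k S fun x => orthProj (tangentSpace S x) (Pi.single j 1) := by
  unfold IsSemialgebraicMapOn
  convert (isSemialgebraic_graph_orthProj_sum (k := k) hS hSsa j).preimage_comp
    (finSumFinEquiv : Fin p ⊕ Fin p → Fin (p + p)) using 1
  ext z
  simp only [mem_setOf_eq, mem_preimage, Function.comp_apply, finSumFinEquiv_apply_left,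
    finSumFinEquiv_apply_right]
  constructor
  · rintro ⟨x, hx, rfl⟩
    simp only [Fin.append_left, Fin.append_right]
    exact ⟨hx, by simp⟩
  · rintro ⟨hx, hu⟩
    refine ⟨fun i => z (Fin.castAdd p i), hx, ?_⟩
    rw [← hu]
    exact (Fin.append_castAdd_natAdd).symm

/-- The scalar entries `x ↦ (π_x e_j)_i` are `k`-semialgebraic functions on `S`.
[cite: BochnakCosteRoy1998, Prop. 2.2.4 and Prop. 3.3.11] -/
theorem isSemialgebraicFunOn_orthProj_single (hS : IsSubmanifoldOfDim d S)
    (hSsa : IsSemialgebraic k S) (j i : Fin p) :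
    IsSemialgebraicFunOn k S fun x => orthProj (tangentSpace S x) (Pi.single j 1) i :=
  (isSemialgebraicMapOn_iff_forall_holds hSsa).mp (isSemialgebraicMapOn_orthProj_single hS hSsa j) i

end OrthProjSemialgebraic


/-! ### Graphs of smooth maps over a submanifold -/

section Graph

variable {p m d : ℕ} {S : Set (Fin p → ℝ)} {F : (Fin p → ℝ) → (Fin m → ℝ)}

/-- The graph `{(x, F x) | x ∈ S} ⊆ ℝ^{p+m}` of `F` over `S` (appended coordinates; this is the
set whose semialgebraicity defines `IsSemialgebraicMapOn k S F`). [folklore] -/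
def graphSet (S : Set (Fin p → ℝ)) (F : (Fin p → ℝ) → (Fin m → ℝ)) : Set (Fin (p + m) → ℝ) :=
  {z | ∃ x ∈ S, z = Fin.append x (F x)}

/-- `(x, F x) ∈ graphSet S F` for `x ∈ S`. [folklore] -/
theorem append_mem_graphSet {x : Fin p → ℝ} (hx : x ∈ S) : Fin.append x (F x) ∈ graphSet S F :=
  ⟨x, hx, rfl⟩

/-- The first block of a point of the graph lies in `S` and determines the second block.
[folklore] -/
theorem mem_graphSet_iff {z : Fin (p + m) → ℝ} :
    z ∈ graphSet S F ↔ (fun i => z (Fin.castAdd m i)) ∈ S ∧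
      (fun j => z (Fin.natAdd p j)) = F fun i => z (Fin.castAdd m i) := by
  constructor
  · rintro ⟨x, hx, rfl⟩
    simp only [Fin.append_left, Fin.append_right]
    exact ⟨hx, by simp⟩
  · rintro ⟨hx, hF⟩
    refine ⟨_, hx, ?_⟩
    rw [← hF]
    exact (Fin.append_castAdd_natAdd).symm

/-- The first-block projection `ℝ^{p+m} → ℝᵖ` is `C^∞`. [folklore] -/
theorem contDiff_castAddProj : ContDiff ℝ ∞ fun z : Fin (p + m) → ℝ => fun i => z (Fin.castAdd m i) :=
  contDiff_pi.mpr fun i => contDiff_apply ℝ ℝ (Fin.castAdd m i)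

/-- **The graph of a `C^∞` map over a `d`-dimensional submanifold is a `d`-dimensional
submanifold** (charts `t ↦ (φ t, F (φ t))`, left inverse `(y, z) ↦ ψ y`).
[cite: LeeSmoothManifolds2013, Prop. 5.16 ff.] -/
theorem IsSubmanifoldOfDim.graph (hS : IsSubmanifoldOfDim d S) (hF : ContDiff ℝ ∞ F) :
    IsSubmanifoldOfDim d (graphSet S F) := by
  rintro z ⟨x, hx, rfl⟩
  obtain ⟨c, hxU⟩ := hS.exists_chart hx
  refine ⟨{z | (fun i => z (Fin.castAdd m i)) ∈ c.U}, fun t => Fin.append (c.φ t) (F (c.φ t)),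
    fun z => c.ψ fun i => z (Fin.castAdd m i), ?_, ?_, ?_, ?_, ?_, ?_⟩
  · exact c.isOpen_U.preimage contDiff_castAddProj.continuous
  · show (fun i => Fin.append x (F x) (Fin.castAdd m i)) ∈ c.U
    simpa only [Fin.append_left] using hxU
  · refine contDiffOn_pi.mpr fun i => ?_
    refine Fin.addCases (motive := fun i => ContDiffOn ℝ ∞
      (fun t => Fin.append (c.φ t) (F (c.φ t)) i) (Metric.ball 0 1)) (fun j => ?_) (fun j => ?_) i
    · simp only [Fin.append_left]
      exact contDiffOn_pi.mp c.contDiffOn_φ j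
    · simp only [Fin.append_right]
      exact contDiffOn_pi.mp (hF.comp_contDiffOn c.contDiffOn_φ) j
  · exact c.contDiffOn_ψ.comp contDiff_castAddProj.contDiffOn fun z hz => hz
  · intro t ht
    show c.ψ (fun i => Fin.append (c.φ t) (F (c.φ t)) (Fin.castAdd m i)) = t
    simp only [Fin.append_left]
    exact c.ψ_φ t ht
  · ext z
    simp only [mem_image, mem_inter_iff, mem_setOf_eq]
    constructor
    · rintro ⟨t, ht, rfl⟩
      simp only [Fin.append_left]
      exact ⟨append_mem_graphSet (c.φ_mem ht).1, (c.φ_mem ht).2⟩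
    · rintro ⟨hz, hzU⟩
      rw [mem_graphSet_iff] at hz
      obtain ⟨hxS, hFz⟩ := hz
      have hmem : (fun i => z (Fin.castAdd m i)) ∈ c.φ '' Metric.ball 0 1 := by
        rw [c.image_eq]
        exact ⟨hxS, hzU⟩
      obtain ⟨t, ht, hφt⟩ := hmem
      refine ⟨t, ht, ?_⟩
      rw [hφt, ← hFz]
      exact Fin.append_castAdd_natAdd

/-- **Tangent vectors of a graph**: at `(x, F x)`, the tangent velocities of the graph of a map
differentiable at `x ∈ S` are the `(v, DF(x) v)` for `v` a tangent velocity of `S` at `x`.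
[cite: LeeSmoothManifolds2013, Prop. 3.23] -/
theorem tangentVelocities_graph {x : Fin p → ℝ} (hFx : DifferentiableAt ℝ F x) :
    tangentVelocities (graphSet S F) (Fin.append x (F x)) =
      (fun v => Fin.append v (fderiv ℝ F x v)) '' tangentVelocities S x := by
  ext w
  constructor
  · rintro ⟨δ, hδS, hδ0, hδw⟩
    set γ : ℝ → Fin p → ℝ := fun s i => δ s (Fin.castAdd m i) with hγ
    have hγ0 : γ 0 = x := by
      funext i
      simp [hγ, hδ0]
    have hγd : HasDerivAt γ (fun i => w (Fin.castAdd m i)) 0 :=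
      hasDerivAt_pi.mpr fun i => (hasDerivAt_pi.mp hδw) (Fin.castAdd m i)
    have hγS : ∀ᶠ s in 𝓝 (0 : ℝ), γ s ∈ S := hδS.mono fun s hs => (mem_graphSet_iff.mp hs).1
    refine ⟨fun i => w (Fin.castAdd m i), ⟨γ, hγS, hγ0, hγd⟩, ?_⟩
    -- second block: `w (natAdd j) = (DF v) j`
    have hFγ : HasDerivAt (fun s => F (γ s)) (fderiv ℝ F x fun i => w (Fin.castAdd m i)) 0 := by
      have hF' : HasFDerivAt F (fderiv ℝ F x) (γ 0) := by
        rw [hγ0]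
        exact hFx.hasFDerivAt
      exact hF'.comp_hasDerivAt (0 : ℝ) hγd
    have hsec : ∀ j, w (Fin.natAdd p j) = fderiv ℝ F x (fun i => w (Fin.castAdd m i)) j := by
      intro j
      have h1 : HasDerivAt (fun s => δ s (Fin.natAdd p j)) (w (Fin.natAdd p j)) 0 :=
        (hasDerivAt_pi.mp hδw) (Fin.natAdd p j)
      have h2 : HasDerivAt (fun s => F (γ s) j) (fderiv ℝ F x (fun i => w (Fin.castAdd m i)) j) 0 :=
        (hasDerivAt_pi.mp hFγ) j
      have heq : (fun s => F (γ s) j) =ᶠ[𝓝 0] fun s => δ s (Fin.natAdd p j) := by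
        filter_upwards [hδS] with s hs
        have h := (mem_graphSet_iff.mp hs).2
        exact (congrFun h j).symm
      exact h1.unique (h2.congr_of_eventuallyEq heq.symm)
    funext i
    refine Fin.addCases (fun j => ?_) (fun j => ?_) i
    · simp
    · simp only [Fin.append_right]
      exact (hsec j).symm
  · rintro ⟨v, ⟨γ, hγS, hγ0, hγv⟩, rfl⟩
    refine ⟨fun s => Fin.append (γ s) (F (γ s)), hγS.mono fun s hs => append_mem_graphSet hs,
      by simp [hγ0], ?_⟩
    have hF' : HasFDerivAt F (fderiv ℝ F x) (γ 0) := by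
      rw [hγ0]
      exact hFx.hasFDerivAt
    have hFγ : HasDerivAt (fun s => F (γ s)) (fderiv ℝ F x v) 0 := hF'.comp_hasDerivAt (0 : ℝ) hγv
    refine hasDerivAt_pi.mpr fun i => ?_
    refine Fin.addCases (motive := fun i => HasDerivAt (fun s => Fin.append (γ s) (F (γ s)) i)
      (Fin.append v (fderiv ℝ F x v) i) 0) (fun j => ?_) (fun j => ?_) i
    · simp only [Fin.append_left]
      exact (hasDerivAt_pi.mp hγv) j
    · simp only [Fin.append_right]
      exact (hasDerivAt_pi.mp hFγ) j

/-- **The derivative along a submanifold read off the graph**: for `x ∈ S` (a `C^∞` submanifold),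
`u ∈ T_x S` and `F` of class `C^∞`, the vector `(u, w)` is a secant direction of the graph of `F`
over `S` at `(x, F x)` iff `w = DF(x) u`. [folklore] -/
theorem append_mem_secantCone_graph_iff (hS : IsSubmanifoldOfDim d S) (hF : ContDiff ℝ ∞ F)
    {x : Fin p → ℝ} (hx : x ∈ S) {u : Fin p → ℝ} (hu : u ∈ tangentSpace S x) (w : Fin m → ℝ) :
    Fin.append u w ∈ secantCone (graphSet S F) (Fin.append x (F x)) ↔ w = fderiv ℝ F x u := by
  have hG := hS.graph hF
  have hpt : Fin.append x (F x) ∈ graphSet S F := append_mem_graphSet hx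
  have hFx : DifferentiableAt ℝ F x := hF.differentiable (by simp) x
  rw [secantCone_eq_tangentSpace hG hpt, coe_tangentSpace hG hpt, tangentVelocities_graph hFx]
  constructor
  · rintro ⟨v, -, hv⟩
    have h1 : v = u := by
      funext i
      simpa only [Fin.append_left] using congrFun hv (Fin.castAdd m i)
    subst h1
    funext j
    simpa only [Fin.append_right] using (congrFun hv (Fin.natAdd p j)).symm
  · rintro rfl
    exact ⟨u, (mem_tangentSpace_iff hS hx).mp hu, rfl⟩

end Graph

/-! ### Directional derivatives along semialgebraic tangent fields are semialgebraic -/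

section Derivative

variable {k : Type*} [CommRing k] [Algebra k ℝ] {p m d : ℕ} {S : Set (Fin p → ℝ)}
  {F : (Fin p → ℝ) → (Fin m → ℝ)} {u : (Fin p → ℝ) → (Fin p → ℝ)}

/-- Index type `(x, w)` of the graph of `x ↦ DF(x)(u x)`. [folklore] -/
abbrev DerIdx₀ (p m : ℕ) := Fin p ⊕ Fin m
/-- … with the block `u' = u x` adjoined. [folklore] -/
abbrev DerIdx₁ (p m : ℕ) := DerIdx₀ p m ⊕ Fin p
/-- … with the block `f = F x` adjoined: all variables of the derivative formula. [folklore] -/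
abbrev DerIdx₂ (p m : ℕ) := DerIdx₁ p m ⊕ Fin m

/-- Composing a valuation with an `addCases` index map gives appended blocks. [folklore] -/
theorem comp_addCases {α : Type*} {a b : ℕ} (w : α → ℝ) (f : Fin a → α) (g : Fin b → α) :
    (w ∘ Fin.addCases (motive := fun _ => α) f g) = Fin.append (w ∘ f) (w ∘ g) := by
  funext i
  refine Fin.addCases (fun j => ?_) (fun j => ?_) i
  · simp
  · simp

/-- The index map reading `(x, u')` inside the derivative variables. [folklore] -/
def derθu (p m : ℕ) : Fin (p + p) → DerIdx₂ p m :=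
  Fin.addCases (motive := fun _ => DerIdx₂ p m) (fun i => Sum.inl (Sum.inl (Sum.inl i)))
    (fun i => Sum.inl (Sum.inr i))

/-- The index map reading `(x, f)` inside the derivative variables. [folklore] -/
def derθF (p m : ℕ) : Fin (p + m) → DerIdx₂ p m :=
  Fin.addCases (motive := fun _ => DerIdx₂ p m) (fun i => Sum.inl (Sum.inl (Sum.inl i))) Sum.inr

/-- The index map reading `((x, f), (u', w))` inside the derivative variables. [folklore] -/
def derθT (p m : ℕ) : Fin ((p + m) + (p + m)) → DerIdx₂ p m :=
  Fin.addCases (motive := fun _ => DerIdx₂ p m) (derθF p m)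
    (Fin.addCases (motive := fun _ => DerIdx₂ p m) (fun i => Sum.inl (Sum.inr i))
      (fun j => Sum.inl (Sum.inl (Sum.inr j))))

/-- The matrix of the derivative formula: `(x, u') ∈ graph u ∧ (x, f) ∈ graph F ∧
((x, f), (u', w)) ∈` secant bundle of the graph of `F`. [folklore] -/
def derMatrix (S : Set (Fin p → ℝ)) (F : (Fin p → ℝ) → (Fin m → ℝ)) (u : (Fin p → ℝ) → (Fin p → ℝ)) :
    Set (DerIdx₂ p m → ℝ) :=
  {w | (w ∘ derθu p m) ∈ graphSet S u ∧ (w ∘ derθF p m) ∈ graphSet S F ∧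
    (w ∘ derθT p m) ∈ {z : Fin ((p + m) + (p + m)) → ℝ |
      (fun i => z (Fin.castAdd (p + m) i)) ∈ graphSet S F ∧
      (fun i => z (Fin.natAdd (p + m) i)) ∈ secantCone (graphSet S F) fun i => z (Fin.castAdd (p + m) i)}}

/-- The matrix of the derivative formula is semialgebraic. [cite: BochnakCosteRoy1998, Prop. 2.2.4] -/
theorem isSemialgebraic_derMatrix (hFsa : IsSemialgebraicMapOn k S F) (husa : IsSemialgebraicMapOn k S u) :
    IsSemialgebraic k (derMatrix S F u) := by
  have hΓF : IsSemialgebraic k (graphSet S F) := hFsa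
  have hΓu : IsSemialgebraic k (graphSet S u) := husa
  have hTB := isSemialgebraic_secantBundle (k := k) hΓF
  exact (hΓu.preimage_comp (derθu p m)).inter
    ((hΓF.preimage_comp (derθF p m)).inter (hTB.preimage_comp (derθT p m)))

/-- Pointwise meaning of the derivative matrix. [folklore] -/
theorem mem_derMatrix_iff (hS : IsSubmanifoldOfDim d S) (hF : ContDiff ℝ ∞ F)
    (hut : ∀ x ∈ S, u x ∈ tangentSpace S x) (z : DerIdx₀ p m → ℝ) (u' : Fin p → ℝ)
    (f : Fin m → ℝ) :
    Sum.elim (Sum.elim z u') f ∈ derMatrix S F u ↔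
      (fun i => z (Sum.inl i)) ∈ S ∧ u' = u (fun i => z (Sum.inl i)) ∧
        f = F (fun i => z (Sum.inl i)) ∧
        (fun j => z (Sum.inr j)) = fderiv ℝ F (fun i => z (Sum.inl i)) (u fun i => z (Sum.inl i)) := by
  set x : Fin p → ℝ := fun i => z (Sum.inl i) with hx
  set w' : Fin m → ℝ := fun j => z (Sum.inr j) with hw'
  have eθu : (Sum.elim (Sum.elim z u') f ∘ derθu p m) = Fin.append x u' := by
    rw [derθu, comp_addCases]
    rfl
  have eθF : (Sum.elim (Sum.elim z u') f ∘ derθF p m) = Fin.append x f := by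
    rw [derθF, comp_addCases]
    rfl
  have eθT : (Sum.elim (Sum.elim z u') f ∘ derθT p m) =
      Fin.append (Fin.append x f) (Fin.append u' w') := by
    rw [derθT, comp_addCases, eθF, comp_addCases]
    rfl
  simp only [derMatrix, mem_setOf_eq, eθu, eθF, eθT, Fin.append_left, Fin.append_right]
  change (Fin.append x u' ∈ graphSet S u ∧ Fin.append x f ∈ graphSet S F ∧
      Fin.append x f ∈ graphSet S F ∧
        Fin.append u' w' ∈ secantCone (graphSet S F) (Fin.append x f)) ↔ _
  rw [mem_graphSet_iff, mem_graphSet_iff]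
  simp only [Fin.append_left, Fin.append_right]
  constructor
  · rintro ⟨⟨hxS, hu'⟩, ⟨-, hf⟩, -, hsec⟩
    have hxS' : x ∈ S := hxS
    have hu'' : u' = u x := hu'
    have hf' : f = F x := hf
    refine ⟨hxS', hu'', hf', ?_⟩
    rw [hu'', hf'] at hsec
    exact (append_mem_secantCone_graph_iff hS hF hxS' (hut x hxS') w').mp hsec
  · rintro ⟨hxS, hu', hf, hw⟩
    refine ⟨⟨hxS, hu'⟩, ⟨hxS, hf⟩, ⟨hxS, hf⟩, ?_⟩
    rw [hf, hu']
    exact (append_mem_secantCone_graph_iff hS hF hxS (hut x hxS) w').mpr hw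

/-- **Directional derivatives along semialgebraic tangent fields are semialgebraic.** Let
`S ⊆ ℝᵖ` be a `k`-semialgebraic `C^∞` submanifold, `F : ℝᵖ → ℝᵐ` a `C^∞` map which is
`k`-semialgebraic on `S`, and `u` a `k`-semialgebraic map on `S` with `u x ∈ T_x S` for `x ∈ S`.
Then `x ↦ DF(x)(u x)` is a `k`-semialgebraic map on `S`: its graph is read off the tangent bundle
of the graph of `F` (a semialgebraic submanifold), `(u x, w) ∈ T_{(x, F x)} Γ_F ↔ w = DF(x)(u x)`.
[cite: BochnakCosteRoy1998, Prop. 2.2.4 and Prop. 3.3.11]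
[cite: BasuPollackRoy2006, Prop. 3.22 and §3.3 (derivatives of semi-algebraic functions)] -/
theorem isSemialgebraicMapOn_fderiv_apply (hS : IsSubmanifoldOfDim d S) (hSsa : IsSemialgebraic k S)
    (hF : ContDiff ℝ ∞ F) (hFsa : IsSemialgebraicMapOn k S F) (husa : IsSemialgebraicMapOn k S u)
    (hut : ∀ x ∈ S, u x ∈ tangentSpace S x) :
    IsSemialgebraicMapOn k S fun x => fderiv ℝ F x (u x) := by
  have hM := isSemialgebraic_derMatrix (k := k) hFsa husa
  have h1 := hM.exists_sum_elim
  have h0 := h1.exists_sum_elim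
  -- `h0 : {z : DerIdx₀ | ∃ u', ∃ f, elim (elim z u') f ∈ derMatrix}` is semialgebraic
  have key : IsSemialgebraic k {z : DerIdx₀ p m → ℝ | (fun i => z (Sum.inl i)) ∈ S ∧
      (fun j => z (Sum.inr j)) =
        fderiv ℝ F (fun i => z (Sum.inl i)) (u fun i => z (Sum.inl i))} := by
    refine sa_of_iff h0 fun z => ?_
    simp only [mem_setOf_eq]
    constructor
    · rintro ⟨hx, hw⟩
      exact ⟨u fun i => z (Sum.inl i), F fun i => z (Sum.inl i),
        (mem_derMatrix_iff hS hF hut z _ _).mpr ⟨hx, rfl, rfl, hw⟩⟩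
    · rintro ⟨u', f, h⟩
      obtain ⟨hx, -, -, hw⟩ := (mem_derMatrix_iff hS hF hut z u' f).mp h
      exact ⟨hx, hw⟩
  have _ := hSsa
  unfold IsSemialgebraicMapOn
  convert key.preimage_comp (finSumFinEquiv : Fin p ⊕ Fin m → Fin (p + m)) using 1
  ext z
  simp only [mem_setOf_eq, mem_preimage, Function.comp_apply, finSumFinEquiv_apply_left,
    finSumFinEquiv_apply_right]
  constructor
  · rintro ⟨x, hx, rfl⟩
    simp only [Fin.append_left, Fin.append_right]
    exact ⟨hx, by simp⟩
  · rintro ⟨hx, hw⟩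
    refine ⟨fun i => z (Fin.castAdd m i), hx, ?_⟩
    rw [← hw]
    exact (Fin.append_castAdd_natAdd).symm

/-- Scalar form: the components `x ↦ (DF(x)(u x))_j` are `k`-semialgebraic functions on `S`.
[cite: BochnakCosteRoy1998, Prop. 2.2.4] -/
theorem isSemialgebraicFunOn_fderiv_apply (hS : IsSubmanifoldOfDim d S) (hSsa : IsSemialgebraic k S)
    (hF : ContDiff ℝ ∞ F) (hFsa : IsSemialgebraicMapOn k S F) (husa : IsSemialgebraicMapOn k S u)
    (hut : ∀ x ∈ S, u x ∈ tangentSpace S x) (j : Fin m) :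
    IsSemialgebraicFunOn k S fun x => fderiv ℝ F x (u x) j :=
  (isSemialgebraicMapOn_iff_forall_holds hSsa).mp
    (isSemialgebraicMapOn_fderiv_apply hS hSsa hF hFsa husa hut) j

end Derivative

end Literature.AlgebraicGeometry.RealAlgebraic

end
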